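import Summits.CriticalPhenomena.SAWScalingLimit.Theses.SAWExcursionCardy
import Summits.CriticalPhenomena.SAWScalingLimit.Theorems.SAWRenewalTightnessEventualTightOfVirginArc

/-!
# `EventualTight` (stmt-CriticalPhenomena-1372), line `Sketch` v8: the crux from its two leaf ITEMS, by name

Crux stmt-CriticalPhenomena-1372 (`SAWRenewalTightness.EventualTight`), line `Sketch`, registration v8 (leads c5/c6).  Both open
stubs of the skeleton are first-class ledger items with byte-identical bodies:

* X2c₁ `stub_virginArcTraversalTight` = stmt-CriticalPhenomena-17940 `SAWExcursionCardy.VirginArcTraversalTight` (the virgin-arc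
  annulus-traversal atom of the critical `ℤ²` self-avoiding arc measure, uniform over exteriors);
* E `stub_confinementPositivity` = stmt-CriticalPhenomena-17587 `SAWRenewalTightness.ConfinementPositivity` (restriction positivity).

This file states the end state of the line with the leaves named as ROUTE DECLS (so that closing the two items closes the crux by
`EventualTight_of_items VirginArcTraversalTight_holds ConfinementPositivity_holds`, one line), composed from landed theorems only:
`eventualTight_of_virginArcTraversalTight_of_confinementPositivity` (…OfVirginArc.lean: virginization V1–V4, aspect reduction A, split
glue) and `bulkShellTight_of_virginArcTraversalTight` (…BulkOfVirginArc.lean) for the bulk child stmt-CriticalPhenomena-17588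
`SAWRenewalTightness.BulkShellTight`.  Neither hypothesis is asserted here (both research-grade).
[cite: AizenmanBurchardDuke1999, Thm 1.1] [cite: KemppainenSmirnov2017, Thm 1.5]
-/

noncomputable section

namespace Summit.CriticalPhenomena.SAWScalingLimit.Theorems

open Summit.CriticalPhenomena.SAWScalingLimit.Theses

/-- **The crux from its two leaf items, by name**: `VirginArcTraversalTight` (stmt-CriticalPhenomena-17940) and
`ConfinementPositivity` (stmt-CriticalPhenomena-17587) imply `EventualTight` (stmt-CriticalPhenomena-1372) — the composition
`eventualTight_of_virginArcTraversalTight_of_confinementPositivity` with the item bodies unfolded definitionally. [folklore] -/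
theorem EventualTight_of_items :
    SAWExcursionCardy.VirginArcTraversalTight → SAWRenewalTightness.ConfinementPositivity →
      SAWRenewalTightness.EventualTight :=
  fun hX hE => eventualTight_of_virginArcTraversalTight_of_confinementPositivity hX hE

/-- **The bulk child from the atom item, by name**: `VirginArcTraversalTight` (stmt-CriticalPhenomena-17940) implies
`BulkShellTight` (stmt-CriticalPhenomena-17588) — `bulkShellTight_of_virginArcTraversalTight` with the item bodies unfolded.
[folklore] -/
theorem BulkShellTight_of_item :
    SAWExcursionCardy.VirginArcTraversalTight → SAWRenewalTightness.BulkShellTight :=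
  fun hX => bulkShellTight_of_virginArcTraversalTight hX

end Summit.CriticalPhenomena.SAWScalingLimit.Theorems

end
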